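import Mathlib
import Summits.MatrixMultiplication.Statement
import Literature.Computability.AlgebraicComplexity.ArithCircuitChain
import Summits.MatrixMultiplication.MatrixMultiplication.Theorems.GraphEquationsCubicDictionary

/-!
# GraphEquations — the cubic dictionary, converse: `C3ₙ ⟹ AQRₙ` for every `n` (M44; cell `decomp-mm`, lens-5 g40)

Helper kernel beneath the attacked crux `MultiplicityReduction` (stmt-MatrixMultiplication-27806) of
route `GraphEquations`, rung `K = 3` (`GraphEquationsCubicRung.CubicReduction`).

`GraphEquationsCubicDictionary` proved `AQRₙ ⟹ C3ₙ` for `n ≥ 3` through the cubic normal form.  Here the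
converse, for EVERY `n`: an affine system `S` (`GraphEquationsAffineQuadric.AffSystem`) is realised by an
honest fan-in-two equation system `E` whose tests are exactly the polynomials `Σ_q g_q f_q` of the affine
tests (`exists_eqSystem_of_affSystem`; the circuit is synthesised test by test with the Literature's
substitution circuits `ArithCircuit.substCircuit` and one exposing sum gate per test,
`exists_gates_exposing` — a multi-output form of `exists_computes_size_eq_complexity`); `E` is correct iff
`S` is, `E` is cubic (`AffTest.totalDegree_poly_le`), and full rank `n²` of the `C`-Jacobian of `E` at a
graph point `(A,B,AB)` is reducedness of `S` at `(A,B)` (`AffTest.eval_pderiv_poly`).  Hence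
`affineQuadricRigidity_of_cubicReduction : CubicReduction n → AffSystem.AffineQuadricRigidity n` and, with
M43, the EQUIVALENCE `affineQuadricRigidity_iff_cubicReduction (hn : 3 ≤ n)`: for `n ≥ 3` the rung-3
statement `C3ₙ` about all cubic straight-line verification systems IS the finite-dimensional statement
`AQRₙ` about families of quadruples `(κ, L_A, L_B, M)` — the redirect loses nothing.  Sorry-free.
-/

set_option linter.dupNamespace false
set_option linter.unusedSectionVars false

noncomputable section

namespace Summit.MatrixMultiplication.MatrixMultiplication.Theorems.GraphEquations

open MvPolynomial Matrix Literature.Computability.AlgebraicComplexity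
open Literature.Computability.AlgebraicComplexity.ArithCircuit

/-! ## Multi-output circuit synthesis -/

section Synthesis

variable {k : Type*} [CommSemiring k] {σ : Type*}

/-- The sum gate `1 • u` exposing the value of the operand `u` as a gate value. -/
def exposeGate (u : Operand k σ) : Gate k σ := .sum [(1, u)]

/-- The exposing gate has fan-in one. -/
theorem fanIn_exposeGate (u : Operand k σ) : (exposeGate u).fanIn = 1 := by
  simp [exposeGate, Gate.fanIn, Gate.args]

/-- The exposing gate evaluates to the operand. -/
theorem eval_exposeGate (u : Operand k σ) (vals : List (MvPolynomial σ k)) :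
    (exposeGate u).eval vals = u.eval vals := by
  simp [exposeGate, Gate.eval]

/-- **Multi-output synthesis.**  Every finite list of polynomials is a list of gate VALUES of one
fan-in-two gate list (at recorded in-range indices). -/
theorem exists_gates_exposing (l : List (MvPolynomial σ k)) :
    ∃ (gs : List (Gate k σ)) (idx : List ℕ), (∀ g ∈ gs, g.fanIn ≤ 2) ∧ (∀ j ∈ idx, j < gs.length) ∧
      idx.map (fun j => (gateValues gs).getD j 0) = l := by
  induction l with
  | nil => exact ⟨[], [], by simp, by simp, rfl⟩
  | cons f l ih =>
    obtain ⟨gs₀, idx₀, hfan₀, hlt₀, hval₀⟩ := ih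
    obtain ⟨P, hP2, hPf, -⟩ := exists_computes_size_eq_complexity f
    let Q : ArithCircuit k σ := P.substCircuit gs₀ Operand.var
    have hQgates : Q.gates = gs₀ ++ P.gates.map (Gate.subst Operand.var gs₀.length) := rfl
    have hQeval : Q.eval = f := by
      have h := eval_substCircuit P gs₀ (ρ := Operand.var) (h := X) (fun i ws => rfl)
      have hPf' : P.eval = f := hPf
      rw [h, hPf', MvPolynomial.aeval_X_left_apply]
    refine ⟨Q.gates ++ [exposeGate Q.output], Q.gates.length :: idx₀, ?_, ?_, ?_⟩
    · intro g hg
      rw [List.mem_append, List.mem_singleton] at hg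
      rcases hg with hg | rfl
      · exact IsFanInTwo.substCircuit hP2 hfan₀ Operand.var g hg
      · rw [fanIn_exposeGate]; norm_num
    · intro j hj
      rw [List.mem_cons] at hj
      rw [List.length_append, List.length_singleton]
      rcases hj with rfl | hj
      · exact Nat.lt_succ_self _
      · have h1 := hlt₀ j hj
        rw [hQgates, List.length_append]
        omega
    · rw [List.map_cons, ← hval₀]
      congr 1
      · rw [gateValues_append_singleton,
          List.getD_append_right _ _ _ _ (by rw [gateValues_length]), gateValues_length, Nat.sub_self,
          List.getD_cons_zero, eval_exposeGate]
        exact hQeval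
      · apply List.map_congr_left
        intro j hj
        obtain ⟨tl, htl⟩ := gateValues_prefix gs₀
          (P.gates.map (Gate.subst Operand.var gs₀.length) ++ [exposeGate Q.output])
        rw [hQgates, List.append_assoc, htl,
          List.getD_append _ _ _ _ (by rw [gateValues_length]; exact hlt₀ j hj)]

end Synthesis

variable {n : ℕ}

/-! ## Degrees -/

/-- `deg f_q ≤ 2`. -/
theorem totalDegree_generator_le_two (n : ℕ) (q : Fin n × Fin n) : (generator n q).totalDegree ≤ 2 := by
  unfold generator
  refine (totalDegree_sub _ _).trans (max_le ?_ ?_)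
  · exact (totalDegree_X (R := ℂ) _).le.trans (by norm_num)
  · refine (totalDegree_finsetSum _ _).trans (Finset.sup_le fun k _ => ?_)
    refine (totalDegree_mul _ _).trans ?_
    exact Nat.add_le_add (totalDegree_X (R := ℂ) _).le (totalDegree_X (R := ℂ) _).le

namespace AffTest

variable (g : AffTest n)

/-- The coefficients `g_q` are affine-linear: degree `≤ 1`. -/
theorem totalDegree_coefPoly_le (q : Fin n × Fin n) : (g.coefPoly q).totalDegree ≤ 1 := by
  have hCX : ∀ (c : ℂ) (v : GraphVars n), (C c * X v : MvPolynomial (GraphVars n) ℂ).totalDegree ≤ 1 :=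
    fun c v => (totalDegree_mul _ _).trans (by rw [totalDegree_C, totalDegree_X, zero_add])
  have hS : ∀ (c : Fin n × Fin n → ℂ) (v : Fin n × Fin n → GraphVars n),
      (∑ i, C (c i) * X (v i) : MvPolynomial (GraphVars n) ℂ).totalDegree ≤ 1 :=
    fun c v => (totalDegree_finsetSum _ _).trans (Finset.sup_le fun i _ => hCX _ _)
  unfold coefPoly
  refine (totalDegree_add _ _).trans (max_le ((totalDegree_add _ _).trans (max_le
    ((totalDegree_add _ _).trans (max_le ?_ ?_)) ?_)) ?_)
  · rw [totalDegree_C]; exact Nat.zero_le _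
  · exact hS (fun v => g.LA q v) aVar
  · exact hS (fun w => g.LB q w) bVar
  · exact hS (fun q' => g.M q q') cVar

/-- **Affine tests are cubic:** `deg Σ_q g_q f_q ≤ 3`. -/
theorem totalDegree_poly_le : g.poly.totalDegree ≤ 3 := by
  unfold poly
  refine (totalDegree_finsetSum _ _).trans (Finset.sup_le fun q _ => ?_)
  refine (totalDegree_mul _ _).trans ?_
  have h1 := g.totalDegree_coefPoly_le q
  have h2 := totalDegree_generator_le_two n q
  omega

end AffTest

/-! ## Realising an affine system by an equation system -/

/-- **Realisation.**  Every affine system is the test list of a fan-in-two equation system: the test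
polynomials of `E` are exactly the `Σ_q g_q f_q` of the affine tests. -/
theorem exists_eqSystem_of_affSystem (S : AffSystem n) :
    ∃ E : EqSystem n, E.circuit.IsFanInTwo ∧
      (∀ j ∈ E.tests, ∃ o, E.testPoly j = (S.test o).poly) ∧
      (∀ o, ∃ j ∈ E.tests, E.testPoly j = (S.test o).poly) := by
  obtain ⟨gs, idx, hfan, -, hval⟩ :=
    exists_gates_exposing ((List.finRange S.m).map fun o => (S.test o).poly)
  refine ⟨⟨⟨gs, .const 0⟩, idx⟩, hfan, fun j hj => ?_, fun o => ?_⟩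
  · have hm : (gateValues gs).getD j 0 ∈ (List.finRange S.m).map fun o => (S.test o).poly := by
      rw [← hval]; exact List.mem_map_of_mem hj
    obtain ⟨o, -, ho⟩ := List.mem_map.1 hm
    exact ⟨o, ho.symm⟩
  · have hm : (S.test o).poly ∈ idx.map fun j => (gateValues gs).getD j 0 := by
      rw [hval]; exact List.mem_map_of_mem (List.mem_finRange o)
    obtain ⟨j, hj, hjo⟩ := List.mem_map.1 hm
    exact ⟨j, hj, hjo⟩

/-- A realisation of a correct affine system is a correct equation system. -/
theorem correct_of_realises {S : AffSystem n} (hS : S.Correct) {E : EqSystem n}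
    (hfan : E.circuit.IsFanInTwo) (hto : ∀ j ∈ E.tests, ∃ o, E.testPoly j = (S.test o).poly)
    (hfrom : ∀ o, ∃ j ∈ E.tests, E.testPoly j = (S.test o).poly) : E.Correct := by
  refine ⟨hfan, Set.ext fun x => ⟨fun hx => ?_, fun hx j hj => ?_⟩⟩
  · rw [← pt_eta x]
    refine (pt_mem_mmGraph_iff _ _ _).2 (hS _ _ _ fun o => ?_)
    obtain ⟨j, hj, hjo⟩ := hfrom o
    have h := hx j hj
    rw [hjo, ← pt_eta x, AffTest.eval_pt_poly] at h
    exact h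
  · obtain ⟨o, ho⟩ := hto j hj
    have hC : (fun q => x (Sum.inr q)) = prodVec (fun v => x (Sum.inl (Sum.inl v)))
        (fun w => x (Sum.inl (Sum.inr w))) :=
      (pt_mem_mmGraph_iff _ _ _).1 (by rw [pt_eta]; exact hx)
    rw [ho, ← pt_eta x, AffTest.eval_pt_poly, hC]
    exact AffTest.eval_graph _ _ _

/-- A realisation of an affine system is cubic. -/
theorem isCubic_of_realises {S : AffSystem n} {E : EqSystem n}
    (hto : ∀ j ∈ E.tests, ∃ o, E.testPoly j = (S.test o).poly) : E.IsCubic := by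
  intro o
  obtain ⟨o', ho'⟩ := hto (E.tests.get o) (List.get_mem _ _)
  rw [ho']
  exact (S.test o').totalDegree_poly_le

/-- Full rank `n²` of the `C`-Jacobian of a realisation at the graph point `(A,B,AB)` is affine
reducedness at `(A,B)`. -/
theorem affReducedAt_of_reducedAt {S : AffSystem n} {E : EqSystem n}
    (hto : ∀ j ∈ E.tests, ∃ o, E.testPoly j = (S.test o).poly) {A B : Vec n}
    (hred : E.ReducedAt (pt A B (prodVec A B))) : S.ReducedAt A B := by
  classical
  intro δ hδ
  set J := E.jacobianC (pt A B (prodVec A B)) with hJ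
  have hJδ : J *ᵥ δ = 0 := by
    ext s
    obtain ⟨o, ho⟩ := hto (E.tests.get s) (List.get_mem _ _)
    have h := hδ o
    simp only [dotProduct] at h
    simp only [hJ, EqSystem.jacobianC, mulVec, dotProduct, Matrix.of_apply, Pi.zero_apply, ho,
      AffTest.eval_pderiv_poly]
    exact h
  have hrange : Module.finrank ℂ (LinearMap.range J.mulVecLin) = n * n := hred
  have hsum := LinearMap.finrank_range_add_finrank_ker J.mulVecLin
  rw [hrange, Module.finrank_fintype_fun_eq_card, Fintype.card_prod, Fintype.card_fin] at hsum
  have hker : LinearMap.ker J.mulVecLin = ⊥ := Submodule.finrank_eq_zero.1 (by omega)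
  have hmem : δ ∈ LinearMap.ker J.mulVecLin := by
    rw [LinearMap.mem_ker, Matrix.mulVecLin_apply]; exact hJδ
  rw [hker] at hmem
  exact (Submodule.mem_bot ℂ).1 hmem

/-- **The converse dictionary (every `n`): cubic reduction implies affine–quadric rigidity.** -/
theorem affineQuadricRigidity_of_cubicReduction (h : CubicReduction n) :
    AffSystem.AffineQuadricRigidity n := by
  intro S hS
  obtain ⟨E, hfan, hto, hfrom⟩ := exists_eqSystem_of_affSystem S
  obtain ⟨x, hx, hred⟩ := h E (correct_of_realises hS hfan hto hfrom) (isCubic_of_realises hto)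
  set A : Vec n := fun v => x (Sum.inl (Sum.inl v))
  set B : Vec n := fun w => x (Sum.inl (Sum.inr w))
  have hC : (fun q => x (Sum.inr q)) = prodVec A B :=
    (pt_mem_mmGraph_iff _ _ _).1 (by rw [pt_eta]; exact hx)
  have hx' : x = pt A B (prodVec A B) := by rw [← hC]; exact (pt_eta x).symm
  rw [hx'] at hred
  exact ⟨A, B, affReducedAt_of_reducedAt hto hred⟩

/-- **`AQRₙ ⟺ C3ₙ` for `n ≥ 3`.** -/
theorem affineQuadricRigidity_iff_cubicReduction (hn : 3 ≤ n) :
    AffSystem.AffineQuadricRigidity n ↔ CubicReduction n :=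
  ⟨cubicReduction_of_affineQuadricRigidity hn, affineQuadricRigidity_of_cubicReduction⟩

/-- In particular `C3ₙ` for all `n` is: `C3₀, C3₁` (proved), `C3₂`, and `AQRₙ` for `n ≥ 3`. -/
theorem cubicReduction_all_iff :
    (∀ n, CubicReduction n) ↔ (CubicReduction 2 ∧ ∀ n, 3 ≤ n → AffSystem.AffineQuadricRigidity n) :=
  ⟨fun h => ⟨h 2, fun n _ => affineQuadricRigidity_of_cubicReduction (h n)⟩,
    fun h => cubicReduction_all h.1 h.2⟩

end Summit.MatrixMultiplication.MatrixMultiplication.Theorems.GraphEquations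

end
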